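import Summits.QuantumFields.YangMills.Theorems.UnitScaleTiltFluctuationComparisonRegPrGlobalSlackLocalRowChiV4
import Summits.QuantumFields.YangMills.Theorems.UnitScaleTiltFluctuationComparisonRegPrGlobalSlackKernelLegRefOwnV4
import Summits.QuantumFields.YangMills.Theorems.UnitScaleTiltFluctuationComparisonRegPrGlobalSlackTermRefChi
import HarnessLib

/-!
# `UnitScaleTiltFluctuationComparisonRegPrGlobalSlackTermRefChiV4` — THE v4 TWIN (★★OWNER RULING g26-№14 (F-2b); P22b, width seat ym-ust-20520-w2 g4; skeleton v5kD; record-free decls imported from `…GlobalSlackTermRefChi`) of `…GlobalSlackTermRefChi` — THE LOCAL TWO-RUN SLACK ROW OF 3⁗χ AS ONE PER-RUN ROW AGAINST A RUN-COHERENT REFERENCE TERM TABLE, IN RAW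
# TERM CURRENCY (crux `FluctuationComparisonRegPrIntL`, stmt-QuantumFields-20520, pen v5kC stub `stub_globalTwoRunSlackFamChiV4`; width seat ym-ust-20520-w3 g0, OWNER g24 re-point
# 23:08:53Z «the term-currency reference twin» of ★w1 g0's leg-currency `…GlobalSlackKernelLegRef`/`…RefOwn` (p582696/p583370), endorsed by ★r1 g4 23:08:00Z; YM₃ on the
# 3-torus is ladder rung R3, not the Clay problem)

WHY.  3⁗χ's irreducible content is ONE two-run row in raw term currency — the local slack row `GlobalSlackLocalToGlobal.PolymerCauchyMinAtTSlack` of the canonical term function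
`canonPTRows (toCore ∘ p)` at the χ-record's canonical polymerisation (socket of reference `GlobalSlackCanonicalPolymers.K1aLocalSlackRowChiV4`, p582522; = ★r1 g4's
`K1aPolymerRowChiV4` at `σ = 7`).  Over the per-`K` `Classical.choice` witnesses of the hypothesis `OfV3ChiAt` (a SEPARATE existential for every `K`) a genuinely cross-`K` row is
unprovable in principle (finding F-g4-1); ★w1 g0 therefore FACTORS the two cross-run LEG rows through run-independent reference objects ([King1986] Prop. 3.6 read as «each run's
`k`-step objects are within `L^{−γk}` of the `n → ∞` limit», Thm 3.4 uniform in `n`) and reduces them to OWN-indexed per-run rows by pure geometry ((M6) `canonTreeLenRows_refineSet`,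
`TreeLenRefinedOn`, `locMatched_canonRows`).  This file does the same ONE LEVEL LOWER, for the term values themselves, so that a v4 per-run (α) record has the option of displaying
ONE row per run (term closeness to a fixed reference table) instead of five:

* §1 `RefTermFam F` (a run-indexed table of reference term values read at the window datum on the comparison lattice), `RefTermCoherent R` (the table is matched along the
  refinement of point sets — the limit object), the per-run reference row in the form of record `TermRefRowT D PT R b₀ p₀ κ₁ a C` (run `K` at `(1+j, Y)` AND run `K+1` at
  `(2+j, refineSet Y)`, each against ITS OWN entry, indexed like the rows of record), the OWN-indexed row `TermRefOwnRowT` (ONE clause: run `K` on its own lattices, window,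
  domains and tree length), **`termRefRowT_of_own`** (`LocMatched D → TreeLenRefinedOn D → TermRefOwnRowT … → TermRefRowT …`, pure geometry) and
  **`polymerCauchyMinAtTSlack_of_termRef`**: `RefTermCoherent R → TermRefRowT D PT R b₀ p₀ κ₁ a C → PolymerCauchyMinAtTSlack D PT b₀ p₀ κ₁ a σ (2C)` (triangle inequality;
  every slack order `σ`).
* §2 the sockets **`K1aTermRefRowChiV4`** / **`K1aTermRefOwnRowChiV4 L 𝔠 a₀ a₁ a`** (the reference table quantified BEFORE the (α) hypothesis — it depends on the family, the record
  and the coupling only, never on the (α) witnesses), `k1aTermRefRowChiV4_of_own` (geometry discharged at the χ-datum: `locMatched_canonRows`, `treeLenRefinedOn_canonRows`),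
  **`k1aLocalSlackRowChiV4_of_termRefRowChiV4 : K1aTermRefRowChiV4 … → K1aLocalSlackRowChiV4 …`** and the capstones **`globalTwoRunSlackFamChiV4_of_k1aTermRefRowChiV4`** /
  **`globalTwoRunSlackFamChiV4_of_k1aTermRefOwnRowChiV4`** : ⟨THE TEXT OF `stub_globalTwoRunSlackFamChiV4` VERBATIM⟩ (via p582522).
CONSEQUENCE FOR THE v4 (α) RECORD (NODE O), term-currency option: 3⁗χ closes over per-`K` choice witnesses as soon as each run's record DISPLAYS the closeness of its canonical
localised term values (43) on its own `θ(n)`-windows to a FIXED coherent reference table (rate `(L^{−(1+j)})^a`, size `e^{−κ𝓛}·θ(n)²·x⁴`) — ONE row per run, no chart family.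
HONEST FRAMING.  Hypothesis schemas + one triangle inequality + geometry; the per-run reference row is the UNPRINTED content in another shape (for non-abelian d = 3 neither the
limit table nor the rate is in print; [King1986] (3.56)/(3.58)–(3.61) is the abelian-Higgs mechanism); nothing of [Balaban1985UV3]/[King1986] is asserted; registry untouched
(`--supports stmt-QuantumFields-20520`); no claim about the crux, d = 4 or the mass gap.

References: C. King, CMP 102 (1986) 649–677 [King1986] (Thm 3.4 (3.9) p.656, (3.42) p.660, Prop. 3.6 (3.56) p.662, (3.58)–(3.61) p.663); T. Bałaban, CMP 102 (1985) 255–275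
[Balaban1985UV3] ((24)–(25) p.262, (43)–(44) pp.266–267, (57) p.270); CMP 109 (1987) 249–301 [Balaban1987RG1] ((0.1) p.251).
-/

set_option autoImplicit false

noncomputable section

open scoped BigOperators
open Literature.MathematicalPhysics.QuantumFieldTheory.Balaban1983to89
open Literature.MathematicalPhysics.QuantumFieldTheory.Balaban1983to89.T3ContinuumYM3Torus
open Literature.MathematicalPhysics.QuantumFieldTheory.Balaban1983to89.T3UnitScaleTilt
open Literature.MathematicalPhysics.QuantumFieldTheory.Balaban1983to89.T3LevelShift
open Literature.MathematicalPhysics.QuantumFieldTheory.Balaban1983to89.T3AlphaInputsAC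
open Literature.MathematicalPhysics.QuantumFieldTheory.Balaban1983to89.T3AlphaPolymerSocket
open Literature.MathematicalPhysics.QuantumFieldTheory.Balaban1983to89.T3AlphaInputsACTwoRun
open Literature.MathematicalPhysics.QuantumFieldTheory.Balaban1983to89.T3AlphaInputsACTwoRunLevel
open Literature.MathematicalPhysics.QuantumFieldTheory.Balaban1985CMP102
open Literature.MathematicalPhysics.QuantumFieldTheory.Balaban1985CMP102.Setting
open Summit.QuantumFields.Balaban3D.Carriers
open Summit.QuantumFields.Balaban3D.Proofs.Primitives
open Summit.QuantumFields.Balaban3D.Proofs.GroupModelLieC (lieC)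
open Summit.QuantumFields.YangMills.Theorems
open Summit.QuantumFields.YangMills.Theorems.GlobalSlackLocalToGlobal (PolymerCauchyMinAtTSlack)
open Summit.QuantumFields.YangMills.Theorems.GlobalSlackKernelLeg (TreeLenRefinedOn treeLenRefinedOn_canonRows)

/-! ## §1 Reference term tables, the per-run reference rows, geometry and the triangle inequality (abstract datum) -/

namespace Summit.QuantumFields.YangMills.Theorems.GlobalSlackTermRef

variable {F : T3Family} {γ : ℝ}

-- (record-free `RefTermFam`: imported from the v3 module, not restated)

-- (record-free `RefTermCoherent`: imported from the v3 module, not restated)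

-- (record-free `TermRefRowT`: imported from the v3 module, not restated)

-- (record-free `TermRefOwnRowT`: imported from the v3 module, not restated)

-- (record-free `termRefRowT_of_own`: imported from the v3 module, not restated)

-- (record-free `polymerCauchyMinAtTSlack_of_termRef`: imported from the v3 module, not restated)

end Summit.QuantumFields.YangMills.Theorems.GlobalSlackTermRef

/-! ## §2 The χ-sockets: the per-run reference row at the χ-record's canonical polymerisation ⟹ the local slack row ⟹ 3⁗χ, by name -/

namespace Summit.QuantumFields.YangMills.Theorems.GlobalSlackCanonicalPolymers

open Summit.QuantumFields.YangMills.Theorems.GlobalSlackTermRef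

/-- **THE PER-RUN REFERENCE ROW (FORM OF RECORD) AT THE χ-RECORD'S CANONICAL POLYMERISATION** (hypothesis schema, never asserted): a constant `C ≥ 0`, a coupling threshold,
and for every family / coupling in the lane's window a COHERENT REFERENCE TERM TABLE `R` — quantified BEFORE the (α) hypothesis, so it depends on the family, the record and the
coupling only, never on the (α) witnesses — such that every inhabited χ-package admits a coherent family `p : ∀ K, PkgAtV3Chi …` with the given [7]-constants whose canonical
term function obeys the per-run reference row `TermRefRowT` at the χ-datum, decay rate the record's `𝔠.κ`.  No chart family, no letter on the record.
[cite: King1986, Prop. 3.6 (3.56) p.662, (3.58)-(3.61) p.663; Balaban1985UV3, (43)-(44) pp.266-267] -/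
def K1aTermRefRowChiV4 (L : ℕ) (𝔠 : AlphaConsts L (suGroupModel 2).N) (a₀ a₁ a : ℝ) : Prop :=
  ∃ (C γB : ℝ), 0 ≤ C ∧ 0 < γB ∧
    ∀ (F : T3Family) (γ : ℝ) (hF : F.L = L) (hγ : 0 < γ), γ ≤ γB → ∀ (hγ1 : γ ≤ (min (hF ▸ 𝔠).gamma0 1) ^ 2),
      ∃ R : RefTermFam F, RefTermCoherent R ∧
        (AlphaInputsT3AC.OfV4ChiAt F (hF ▸ 𝔠) a₀ a₁ →
          ∃ (p : ∀ K, AlphaInputsT3AC.PkgAtV4Chi F (hF ▸ 𝔠) γ hγ hγ1 K), (∀ K, (p K).a₀ = a₀ ∧ (p K).a₁ = a₁) ∧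
            TermRefRowT (AlphaInputsT3AC.dataOfV4chi p (canonPolymerRows fun K => (p K).toRows)) (canonPTRows fun K => (p K).toRows) R
              (hF ▸ 𝔠).b₀ (hF ▸ 𝔠).p₀ (hF ▸ 𝔠).κ a C)

/-- **THE OWN-INDEXED PER-RUN REFERENCE ROW AT THE χ-RECORD'S CANONICAL POLYMERISATION** (hypothesis schema, never asserted): `K1aTermRefRowChiV4`'s text with the form-of-record row
`TermRefRowT` REPLACED by the own-indexed row `TermRefOwnRowT` (ONE clause per run) and the rate letter `0 ≤ a` kept implicit in the socket's `0 < a` — the shape a v4 per-run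
(α) record would display in term currency. [cite: King1986, Prop. 3.6 (3.56) p.662, (3.58)-(3.61) p.663; Balaban1985UV3, (43)-(44) pp.266-267] -/
def K1aTermRefOwnRowChiV4 (L : ℕ) (𝔠 : AlphaConsts L (suGroupModel 2).N) (a₀ a₁ a : ℝ) : Prop :=
  ∃ (C γB : ℝ), 0 ≤ C ∧ 0 < γB ∧
    ∀ (F : T3Family) (γ : ℝ) (hF : F.L = L) (hγ : 0 < γ), γ ≤ γB → ∀ (hγ1 : γ ≤ (min (hF ▸ 𝔠).gamma0 1) ^ 2),
      ∃ R : RefTermFam F, RefTermCoherent R ∧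
        (AlphaInputsT3AC.OfV4ChiAt F (hF ▸ 𝔠) a₀ a₁ →
          ∃ (p : ∀ K, AlphaInputsT3AC.PkgAtV4Chi F (hF ▸ 𝔠) γ hγ hγ1 K), (∀ K, (p K).a₀ = a₀ ∧ (p K).a₁ = a₁) ∧
            TermRefOwnRowT (AlphaInputsT3AC.dataOfV4chi p (canonPolymerRows fun K => (p K).toRows)) (canonPTRows fun K => (p K).toRows) R
              (hF ▸ 𝔠).b₀ (hF ▸ 𝔠).p₀ (hF ▸ 𝔠).κ a C)

/-- **THE OWN-INDEXED SOCKET GIVES THE FORM OF RECORD AT THE χ-DATUM** for a nonnegative rate exponent (`termRefRowT_of_own`; geometry discharged: `locMatched_canonRows`,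
`GlobalSlackKernelLeg.treeLenRefinedOn_canonRows` (★w1 g0 (M6)); window letters from the record: `0 < 𝔠.κ`, `𝔠.b₀ > 0`, `γ ≤ (min γ₀ 1)² ≤ 1`).
[cite: King1986, Prop. 3.6 (3.56) p.662; Balaban1985UV3, (24)-(25) p.262; Balaban1987RG1, (0.1) p.251] -/
theorem k1aTermRefRowChiV4_of_own {L : ℕ} {𝔠 : AlphaConsts L (suGroupModel 2).N} {a₀ a₁ a : ℝ} (ha : 0 ≤ a) (h : K1aTermRefOwnRowChiV4 L 𝔠 a₀ a₁ a) :
    K1aTermRefRowChiV4 L 𝔠 a₀ a₁ a := by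
  obtain ⟨C, γB, hC, hγB, hall⟩ := h
  refine ⟨C, γB, hC, hγB, fun F γ hF hγ hγle hγ1 => ?_⟩
  subst hF
  obtain ⟨R, hR, hrow⟩ := hall F γ rfl hγ hγle hγ1
  refine ⟨R, hR, fun hOf => ?_⟩
  obtain ⟨p, hp, hT⟩ := hrow hOf
  have hγ1' : γ ≤ 1 := hγ1.trans (sq_min_one_le _ 𝔠.gamma0_pos)
  exact ⟨p, hp, termRefRowT_of_own (locMatched_canonRows fun K => (p K).toRows) (treeLenRefinedOn_canonRows fun K => (p K).toRows)
    (kappa_record_admissible 𝔠).1.le hC ha F.hL.2.le hγ hγ1' 𝔠.b₀_pos hT⟩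

/-- **THE PER-RUN REFERENCE ROW GIVES THE LOCAL SLACK ROW OF REFERENCE** (`K1aLocalSlackRowChiV4`, p582522) with `σ := 7` and constant `2C` (`polymerCauchyMinAtTSlack_of_termRef`;
`1 ≤ L`, `γ ≤ 1`, `0 < b₀` from the family and the record). [cite: King1986, Thm 3.4 (3.9) p.656, Prop. 3.6 (3.56) p.662] -/
theorem k1aLocalSlackRowChiV4_of_termRefRowChiV4 {L : ℕ} {𝔠 : AlphaConsts L (suGroupModel 2).N} {a₀ a₁ a : ℝ} (h : K1aTermRefRowChiV4 L 𝔠 a₀ a₁ a) :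
    K1aLocalSlackRowChiV4 L 𝔠 a₀ a₁ a := by
  obtain ⟨C, γB, hC, hγB, hall⟩ := h
  refine ⟨7, 2 * C, γB, le_rfl, by positivity, hγB, fun F γ hF hγ hγle hγ1 hOf => ?_⟩
  subst hF
  obtain ⟨R, hR, hrow⟩ := hall F γ rfl hγ hγle hγ1
  obtain ⟨p, hp, hT⟩ := hrow hOf
  have hγ1' : γ ≤ 1 := hγ1.trans (sq_min_one_le _ 𝔠.gamma0_pos)
  exact ⟨p, hp, polymerCauchyMinAtTSlack_of_termRef 7 F.hL.2.le hγ hγ1' 𝔠.b₀_pos hC hR hT⟩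

/-- **THE PEN's STUB 3⁗χ `stub_globalTwoRunSlackFamChiV4` FROM THE PER-RUN REFERENCE ROW IN RAW TERM CURRENCY, BY NAME** (text VERBATIM, OWNER C3 pen `birth_v5kC.lean` :43):
`k1aLocalSlackRowChiV4_of_termRefRowChiV4` then p582522's `globalTwoRunSlackFamChiV4_of_k1aLocalSlackRowChiV4`. [cite: King1986, Thm 3.4 (3.9) p.656, (3.42) p.660, Prop. 3.6 (3.56) p.662; Balaban1985UV3, (7) p.257, (43)-(46) pp.266-267, (57) p.270] -/
theorem globalTwoRunSlackFamChiV4_of_k1aTermRefRowChiV4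
    (h : ∀ (L : ℕ), Odd L → 7 ≤ L → ∀ (𝔠 : AlphaConsts L (suGroupModel 2).N) (a₀ a₁ : ℝ), 0 < a₀ → 0 < a₁ → 𝔠.B₃ * a₁ ≤ a₀ →
      ∃ a : ℝ, 0 < a ∧ a < 1 ∧ K1aTermRefRowChiV4 L 𝔠 a₀ a₁ a) :
    ∀ (L : ℕ), Odd L → 7 ≤ L → ∀ (𝔠 : Summit.QuantumFields.Balaban3D.Proofs.Primitives.AlphaConsts L (Summit.QuantumFields.Balaban3D.Carriers.suGroupModel 2).N)
      (a₀ a₁ : ℝ), 0 < a₀ → 0 < a₁ → 𝔠.B₃ * a₁ ≤ a₀ →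
      ∃ a : ℝ, 0 < a ∧ ∃ γB : ℝ, 0 < γB ∧ ∀ (F : T3Family) (γ : ℝ) (hF : F.L = L) (hγ : 0 < γ), γ ≤ γB →
        ∀ (hγ1 : γ ≤ (min (hF ▸ 𝔠).gamma0 1) ^ 2),
          Summit.QuantumFields.YangMills.Theorems.AlphaInputsT3AC.OfV4ChiAt F (hF ▸ 𝔠) a₀ a₁ →
          ∃ (p : ∀ K, Summit.QuantumFields.YangMills.Theorems.AlphaInputsT3AC.PkgAtV4Chi F (hF ▸ 𝔠) γ hγ hγ1 K),
            (∀ K, (p K).a₀ = a₀ ∧ (p K).a₁ = a₁) ∧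
            ∃ (π : Summit.QuantumFields.YangMills.Theorems.AlphaInputsT3AC.PolymerT3 F) (σ : ℕ) (C : ℝ), 7 ≤ σ ∧ 0 ≤ C ∧
              Summit.QuantumFields.YangMills.Theorems.GlobalSlack.GlobalSupRateTSlack (Summit.QuantumFields.YangMills.Theorems.AlphaInputsT3AC.dataOfV4chi p π) (hF ▸ 𝔠).b₀ (hF ▸ 𝔠).p₀ a σ C :=
  globalTwoRunSlackFamChiV4_of_k1aLocalSlackRowChiV4 fun L hLo h7 𝔠 a₀ a₁ ha0 ha1 hw => by
    obtain ⟨a, ha, ha1, hT⟩ := h L hLo h7 𝔠 a₀ a₁ ha0 ha1 hw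
    exact ⟨a, ha, ha1, k1aLocalSlackRowChiV4_of_termRefRowChiV4 hT⟩

/-- **THE PEN's STUB 3⁗χ FROM THE OWN-INDEXED PER-RUN REFERENCE ROW IN RAW TERM CURRENCY, BY NAME** — ONE displayed row per run, no chart family
(`k1aTermRefRowChiV4_of_own` with `0 ≤ a` from the socket's `0 < a`, then `globalTwoRunSlackFamChiV4_of_k1aTermRefRowChiV4`). [cite: King1986, Thm 3.4 (3.9) p.656, Prop. 3.6 (3.56) p.662, (3.58)-(3.61) p.663; Balaban1985UV3, (43)-(46) pp.266-267] -/
theorem globalTwoRunSlackFamChiV4_of_k1aTermRefOwnRowChiV4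
    (h : ∀ (L : ℕ), Odd L → 7 ≤ L → ∀ (𝔠 : AlphaConsts L (suGroupModel 2).N) (a₀ a₁ : ℝ), 0 < a₀ → 0 < a₁ → 𝔠.B₃ * a₁ ≤ a₀ →
      ∃ a : ℝ, 0 < a ∧ a < 1 ∧ K1aTermRefOwnRowChiV4 L 𝔠 a₀ a₁ a) :
    ∀ (L : ℕ), Odd L → 7 ≤ L → ∀ (𝔠 : Summit.QuantumFields.Balaban3D.Proofs.Primitives.AlphaConsts L (Summit.QuantumFields.Balaban3D.Carriers.suGroupModel 2).N)
      (a₀ a₁ : ℝ), 0 < a₀ → 0 < a₁ → 𝔠.B₃ * a₁ ≤ a₀ →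
      ∃ a : ℝ, 0 < a ∧ ∃ γB : ℝ, 0 < γB ∧ ∀ (F : T3Family) (γ : ℝ) (hF : F.L = L) (hγ : 0 < γ), γ ≤ γB →
        ∀ (hγ1 : γ ≤ (min (hF ▸ 𝔠).gamma0 1) ^ 2),
          Summit.QuantumFields.YangMills.Theorems.AlphaInputsT3AC.OfV4ChiAt F (hF ▸ 𝔠) a₀ a₁ →
          ∃ (p : ∀ K, Summit.QuantumFields.YangMills.Theorems.AlphaInputsT3AC.PkgAtV4Chi F (hF ▸ 𝔠) γ hγ hγ1 K),
            (∀ K, (p K).a₀ = a₀ ∧ (p K).a₁ = a₁) ∧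
            ∃ (π : Summit.QuantumFields.YangMills.Theorems.AlphaInputsT3AC.PolymerT3 F) (σ : ℕ) (C : ℝ), 7 ≤ σ ∧ 0 ≤ C ∧
              Summit.QuantumFields.YangMills.Theorems.GlobalSlack.GlobalSupRateTSlack (Summit.QuantumFields.YangMills.Theorems.AlphaInputsT3AC.dataOfV4chi p π) (hF ▸ 𝔠).b₀ (hF ▸ 𝔠).p₀ a σ C :=
  globalTwoRunSlackFamChiV4_of_k1aTermRefRowChiV4 fun L hLo h7 𝔠 a₀ a₁ ha0 ha1 hw => by
    obtain ⟨a, ha, ha1, hT⟩ := h L hLo h7 𝔠 a₀ a₁ ha0 ha1 hw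
    exact ⟨a, ha, ha1, k1aTermRefRowChiV4_of_own ha.le hT⟩

end Summit.QuantumFields.YangMills.Theorems.GlobalSlackCanonicalPolymers

end
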